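import Literature.AlgebraicGeometry.Resolution.ExcellentRingsFieldProofs
import Literature.AlgebraicGeometry.Resolution.QuasiExcellentSchemes
import Literature.AlgebraicGeometry.Motives.ProjectiveNoetherNormalization
import Literature.AlgebraicGeometry.Motives.ProjectiveSpaceHyperplaneMultiplicity
import Literature.AlgebraicGeometry.Resolution.ProjectiveSpaceRegular
import HarnessLib

/-!
# Projective space over a field is an excellent Noetherian scheme of dimension `d`

Standing facts about `ℙ^d_K = Proj K[x₀, …, x_d]` (the tree's `Literature.AlgebraicGeometry.Motives.ProjSpace.P d K`, by
`rfl` the underlying scheme of `Motives.projectiveSpace d K`) recorded BY NAME for consumers that quantify over an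
abstract exceptional scheme `E` with hypotheses `[IsIntegral E] [IsNoetherian E] (Scheme.IsExcellent E)
(topologicalKrullDim E = 3)` and instantiate `E := ℙ^3_{κ₀}` (e.g. the depth-two mixed engine of
`Summits/…/FrobeniusClosingPatchingRelPerfectDepth*`): integrality is the instance `ProjSpace.isIntegral`
(`Motives/ProjectiveSpaceFunctionField`), regularity is `isRegular_projectiveSpace` (`Resolution/ProjectiveSpaceRegular`),
the dimension is `ProjSpace.topologicalKrullDim_eq` (`Motives/ProjectiveNoetherNormalization`); this file adds

* `ProjectiveSpace.isNoetherian_projSpace` — `ℙ^d_K` is Noetherian (locally of finite type and quasi-compact over `K`);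
* `ProjectiveSpace.isExcellent_projSpace` — `ℙ^d_K` is excellent: locally of finite type over a field, every affine
  coordinate ring being a finitely generated `K`-algebra (Stacks 07QW, PROVED in the tree as `Stacks07QW_field_holds`,
  applied through `Scheme.isExcellent_of_locallyOfFiniteType`);
* the same two facts in the `(Motives.projectiveSpace d K).left` spelling, and `isQuasiExcellent_projSpace`.

## References
* The Stacks Project, Tag 07QW (finite type algebras over a field are excellent). [StacksProject]
* H. Matsumura, *Commutative Ring Theory* (1987), §32, p. 260. [Matsumura1987]
* U. Görtz, T. Wedhorn, *Algebraic Geometry I*, 2nd ed. (2020), Example 3.6, (13.2)–(13.4). [GortzWedhorn2020]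
-/

noncomputable section

open CategoryTheory AlgebraicGeometry

namespace Literature.AlgebraicGeometry.Resolution

namespace ProjectiveSpace

universe u

variable (d : ℕ) (K : Type u) [Field K]

/-- **`ℙ^d_K` is Noetherian**: it is locally of finite type (proper) and quasi-compact over `Spec K`.
[cite: GortzWedhorn2020, Example 3.6] -/
theorem isNoetherian_projSpace : IsNoetherian (Motives.ProjSpace.P d K) :=
  Scheme.isNoetherian_of_finiteType_over_field ((Motives.ProjSpace.P d K) ↘ Spec (.of K))

/-- **`ℙ^d_K` is an excellent scheme**: it is locally of finite type over the field `K`, and finitely generated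
algebras over a field are excellent rings (Stacks 07QW, the tree's `Stacks07QW_field_holds`).
[cite: StacksProject, Tag 07QW] [cite: Matsumura1987, §32 p. 260] -/
theorem isExcellent_projSpace : Scheme.IsExcellent (Motives.ProjSpace.P d K) :=
  Scheme.isExcellent_of_locallyOfFiniteType Stacks07QW_field_holds ((Motives.ProjSpace.P d K) ↘ Spec (.of K))

/-- `ℙ^d_K` is quasi-excellent (from excellence). [cite: StacksProject, Tag 07QW] -/
theorem isQuasiExcellent_projSpace : Scheme.IsQuasiExcellent (Motives.ProjSpace.P d K) :=
  (isExcellent_projSpace d K).isQuasiExcellent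

/-- `ℙ^d_K` is Noetherian, in the `(projectiveSpace d K).left` spelling of `Motives/VarietiesProjectiveSpace`.
[cite: GortzWedhorn2020, Example 3.6] -/
theorem isNoetherian_projectiveSpace : IsNoetherian (Motives.projectiveSpace d K).left :=
  isNoetherian_projSpace d K

/-- `ℙ^d_K` is excellent, in the `(projectiveSpace d K).left` spelling of `Motives/VarietiesProjectiveSpace`.
[cite: StacksProject, Tag 07QW] -/
theorem isExcellent_projectiveSpace : Scheme.IsExcellent (Motives.projectiveSpace d K).left :=
  isExcellent_projSpace d K

/-- **The standing facts of `ℙ^d_K` in one package** (the hypothesis shape of the chain's E-side targets): integral,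
Noetherian, regular, excellent, of dimension `d`. [cite: StacksProject, Tag 07QW] [cite: GortzWedhorn2020, Example 3.6] -/
theorem projSpace_standing :
    IsIntegral (Motives.ProjSpace.P d K) ∧ IsNoetherian (Motives.ProjSpace.P d K) ∧
      Scheme.IsRegular (Motives.ProjSpace.P d K) ∧ Scheme.IsExcellent (Motives.ProjSpace.P d K) ∧
      topologicalKrullDim (Motives.ProjSpace.P d K) = d :=
  ⟨inferInstance, isNoetherian_projSpace d K, isRegular_projectiveSpace d K, isExcellent_projSpace d K,
    Motives.ProjSpace.topologicalKrullDim_eq d K⟩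

end ProjectiveSpace

end Literature.AlgebraicGeometry.Resolution

end
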